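import Summits.QuantumFields.YangMills.Theorems.AlphaInputsT3ACv3AbelianLocal
import Summits.QuantumFields.YangMills.Theorems.AlphaInputsT3ACv3Prop1Blocks
import Summits.QuantumFields.YangMills.Theorems.AlphaInputsT3ACv3LocalSmallExact
import HarnessLib

/-!
# `AlphaInputsT3ACv3AbelianRegion` — STRATEGY B for 2′, THE ABELIAN CASE OF (FL) ON A **REGION**: for a one-form `a` whose fine curls are `≤ B` on the plaquettes UNDER a union of
# level-`k` blocks, the `s`-fold (0.4)∕`exp[mean log]` averages of the abelian configuration `gexpAt a` are, AT THE BONDS UNDER THE REGION, the abelian configurations of the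
# iterated linear averages `linAvgIter s a` — two-block-exact locality throughout; no global smallness — lane `pub-balaban3d`, seat alpha-2 (g4)

WHY (HOME memos `D6R-SEAMS-alpha2-g4.md` §6, `D6X-GLUE-alpha2-g4.md` §5; OWNER DEPMAP v3.3: the displayed W-dependent row of 2′ is (FL) `InnerFineLiftsT3` — «abelian case first»).  For an
ABELIAN charged datum `W = gexpAt A` on `bondsIn k Ω_k(h)`, a witness of (FL) is `U := gexpAt a` for any finest one-form `a` with `linAvgIter k a = A` on `bondsIn k Ω_k(h)` and small fine
curls UNDER `Ω_k(h)` — PROVIDED the EML identity `(blockAvg ℰp)^s (gexpAt a) = gexpAt (linAvgIter s a)` holds at the bonds under the region from the regional curl bound alone.  The tree's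
`AbelianEML.iter_blockAvg_gexpAt` (g3) needs the curl bound on the WHOLE torus; THIS FILE proves the regional form with the exact-locality tools of this generation:
* §1 `abs_loopSum_le_twoBlock`: the (0.4) loop sums at `c` are `≤ (π/2)(((d+2)L)²/4)·B` from the curls of the plaquettes of the TWO blocks of `c` only (g3's scaling trick run over
  `BoxStokes.dist1_loopHol_le_twoBlock`).
* §2 `abs_curl_linAvg04_le_fourBlock`: `|curl (linAvg04 a)(y; μ, ν)| ≤ L²·B` from the `(μ,ν)`-curls at the fine positions whose extreme corners lie in the FOUR blocks under the corners of
  the coarse plaquette (g3's `abs_curl_linAvg04_le` + `BoxStokes.blockOf_rectPlaq_mem_four`).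
* §3 ★ `abs_curlAt_linAvgIter_le_region`: on a nested family `R` of coarse-site sets (`z ∈ R i ↔ blockOf z ∈ R (i+1)`), fine curls `≤ B` at the positions with four corners in `R 0` give
  `|curl (linAvgIter s a)| ≤ (L²)^s·B` at the positions with four corners in `R s`.
* §4 ★★ `iter_blockAvg_gexpAt_region`: under the same hypothesis and the level thresholds `(π/2)(((d+2)L)²/4)(L²)^s B‖Y‖ < min(δ_N, ln 2)` (`s < k`), for every `s ≤ k` and every level-`s`
  bond with both endpoints in `R s`: `(blockAvg ℰp)^s (gexpAt a) = gexpAt (linAvgIter s a)` — induction over `LocalSmallLoop.avgFun_local₂`-type exact locality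
  (`T4ReflectionConeSharp.avgFun_congr₂`) and the pointwise EML identity `AbelianEML.blockAvg_gexpAt_apply`.
HONEST FRAMING.  Kernel statements about the tree's own (0.4) objects; nothing of [B10]∕[7]∕[4] asserted; (FL) itself is NOT proved here (the LINEAR lift `a` is the open input, sibling
`…v3AbelianFineLift`); count-neutral helper toward R3 2′ (`stub_laneRecordsV3`, items 19935∕19936); registry untouched; nothing about d = 4, the continuum, or a mass gap.

References: T. Bałaban, Commun. Math. Phys. 109 (1987) 249–301 [Balaban1987RG1] ((0.4), (0.11) p.253); CMP 98 (1985) 17–51 [Balaban1985Averaging] ((19)–(20) p.21, (24) p.21, p.24).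
-/

set_option autoImplicit false

noncomputable section

namespace Summit.QuantumFields.YangMills.Theorems.AbelianEML

open scoped BigOperators Matrix.Norms.L2Operator
open NormedSpace
open Literature.MathematicalPhysics.QuantumFieldTheory.Balaban1983to89
open Literature.MathematicalPhysics.QuantumFieldTheory.Balaban1983to89.T4Continuum
open Literature.MathematicalPhysics.QuantumFieldTheory.Balaban1983to89.BlockAveraging (loopHol off off_bounds Idx blockAvg blockAvg_avg avgFun)
open Literature.MathematicalPhysics.QuantumFieldTheory.Balaban1983to89.BlockAveragingEMLProp2 (shiftN_apply walkEnd_stairWord_apply shift_shift_comm)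
open Literature.MathematicalPhysics.QuantumFieldTheory.Balaban1983to89.B10Eq47AxialChi (shiftN)
open Literature.MathematicalPhysics.QuantumFieldTheory.Balaban1983to89.T4ReflectionConeSharp (avgFun_congr₂)
open Literature.MathematicalPhysics.QuantumFieldTheory.Balaban1985CMP102.Setting
open Summit.QuantumFields.Balaban3D.Carriers
open Summit.QuantumFields.Balaban3D.Proofs.GroupModelSkew (conjTranspose_eq_neg_of_mem_lie)
open Summit.QuantumFields.YangMills.Theorems.BalabanUVNodesN08AlphaAbelianLift (gexp rho_gexp norm_exp_real_smul_sub_one_le abs_mul_norm_le_of_exp)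
open Summit.QuantumFields.YangMills.Theorems.BoxStokes (dist1_loopHol_le_twoBlock blockOf_rectPlaq_mem_four blockOf_mem_four_iff blockOf_mem_pair_iff walkEnd_single_mem_pi)
open ExpMeanLog (expMeanLogSU deltaSU)

variable {P : Params} {j : ℕ} {G : Type} [GaugeGroup G] [MeasurableSpace G] (𝔊 : GroupModel G) {X : Matrix (Fin 𝔊.N) (Fin 𝔊.N) ℂ} (hX : X ∈ 𝔊.lie)

/-! ## §1 Loop sums from the curls of the two blocks -/

/-- **THE (0.4) LOOP SUMS OF A ONE-FORM WITH CURL `≤ B` ON THE TWO BLOCKS OF `c` ARE AT MOST `(π/2)·(((d+2)L)²/4)·B`** (standing range `j + 1 ≤ m + K`): g3's scaling trick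
(`abs_loopSum_le`) run over the two-block Stokes bound `BoxStokes.dist1_loopHol_le_twoBlock`; the hypothesis is on the fine plaquettes whose lower-left and upper-right corners have their
blocks among `{c₋, c₊}`. [cite: Balaban1985Averaging, (19)–(20) p.21; Balaban1987RG1, (0.4) p.253] -/
theorem abs_loopSum_le_twoBlock (hj : j + 1 ≤ P.m + P.K) (hX : X ∈ 𝔊.lie) (hX0 : X ≠ 0) (a : PBond P j → ℝ) {B : ℝ} (hB0 : 0 ≤ B)
    (c : PBond P (j + 1))
    (hB : ∀ p : Plaq P j, (blockOf p.src = c.src ∨ blockOf p.src = c.tgt) →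
      (blockOf ((p.src.shift p.μ).shift p.ν) = c.src ∨ blockOf ((p.src.shift p.μ).shift p.ν) = c.tgt) → |curlAt a p.src p.μ p.ν| ≤ B)
    (i : Idx P) :
    |loopSum a c i| ≤ Real.pi / 2 * (((((P.d + 2) * P.L : ℕ) : ℝ) ^ 2 / 4) * B) := by
  set t := loopSum a c i with ht
  set K : ℝ := ((((P.d + 2) * P.L : ℕ) : ℝ) ^ 2 / 4) with hK
  have hK0 : 0 ≤ K := by positivity
  have hnX : 0 < ‖X‖ := norm_pos_iff.mpr hX0
  have hpi := Real.pi_pos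
  set s : ℝ := Real.pi / (|t| * ‖X‖ + Real.pi) with hs
  have hden : 0 < |t| * ‖X‖ + Real.pi := by positivity
  have hs0 : 0 < s := div_pos hpi hden
  have hstπ : s * (|t| * ‖X‖) ≤ Real.pi := by
    rw [hs, div_mul_eq_mul_div, div_le_iff₀ hden]; nlinarith [abs_nonneg t]
  have hskew := conjTranspose_eq_neg_of_mem_lie 𝔊 hX
  have hmain : ∀ η : ℝ, 0 < η → s * (|t| * ‖X‖) ≤ Real.pi / 2 * (K * (s * B * ‖X‖ + η)) := by
    intro η hη
    -- the rescaled configuration is `(sB‖X‖ + η)`-small on the plaquettes of the two blocks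
    have hsmall : ∀ p : Plaq P j, (blockOf p.src = c.src ∨ blockOf p.src = c.tgt) →
        (blockOf ((p.src.shift p.μ).shift p.ν) = c.src ∨ blockOf ((p.src.shift p.μ).shift p.ν) = c.tgt) →
        dist1 (GaugeField.plaqHol (gexpAt 𝔊 hX fun b => s * a b) p) ≤ s * B * ‖X‖ + η := by
      intro p h1 h2
      refine (dist1_plaqHol_gexpAt_le 𝔊 hX _ p).trans ?_
      rw [curlAt_smul, abs_mul, abs_of_pos hs0]
      have e1 : s * |curlAt a p.src p.μ p.ν| * ‖X‖ ≤ s * B * ‖X‖ :=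
        mul_le_mul_of_nonneg_right (mul_le_mul_of_nonneg_left (hB p h1 h2) hs0.le) (norm_nonneg _)
      linarith
    have hδ0 : 0 ≤ s * B * ‖X‖ + η := by positivity
    have h1 := dist1_loopHol_le_twoBlock hj hδ0 c hsmall i
    rw [loopHol_gexpAt, loopSum_smul, dist1_gexp] at h1
    have hupper : |s * t| * ‖X‖ ≤ Real.pi := by rw [abs_mul, abs_of_pos hs0, mul_assoc]; exact hstπ
    have hlow := abs_mul_norm_le_of_exp hskew hupper
    rw [abs_mul, abs_of_pos hs0, mul_assoc] at hlow
    exact hlow.trans (mul_le_mul_of_nonneg_left h1 (by positivity))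
  have hlim : s * (|t| * ‖X‖) ≤ Real.pi / 2 * (K * (s * B * ‖X‖)) := by
    refine le_of_forall_pos_le_add fun ε hε => ?_
    have hη : 0 < ε / (Real.pi / 2 * K + 1) := div_pos hε (by positivity)
    refine (hmain _ hη).trans ?_
    have : Real.pi / 2 * (K * (ε / (Real.pi / 2 * K + 1))) ≤ ε := by
      rw [← mul_assoc, mul_div_assoc', div_le_iff₀ (by positivity)]; nlinarith
    nlinarith
  have hsX : 0 < s * ‖X‖ := mul_pos hs0 hnX
  have : s * ‖X‖ * |t| ≤ s * ‖X‖ * (Real.pi / 2 * (K * B)) := by nlinarith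
  exact le_of_mul_le_mul_left this hsX

/-! ## §2 The curl of the linear average from the four blocks under the coarse plaquette -/

/-- **`|curl (linAvg04 a)(y; μ, ν)| ≤ L²·B` FROM THE `(μ,ν)`-CURLS AT THE FINE POSITIONS WHOSE EXTREME CORNERS LIE IN THE FOUR BLOCKS** `y, y+e_μ, y+e_ν, y+e_μ+e_ν` (standing range, `μ ≠ ν`):
the transported squares of `curl_linAvg04` tile exactly such positions (`BoxStokes.blockOf_rectPlaq_mem_four`). [cite: Balaban1987RG1, (0.4) p.253; Balaban1985Averaging, (14) p.19] -/
theorem abs_curl_linAvg04_le_fourBlock (hj : j + 1 ≤ P.m + P.K) (a : PBond P j → ℝ) (y : Site P (j + 1)) {μ ν : Fin P.d} (hμν : μ ≠ ν) {B : ℝ}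
    (hB : ∀ x : Site P j, (blockOf x = y ∨ blockOf x = y.shift μ ∨ blockOf x = y.shift ν ∨ blockOf x = (y.shift μ).shift ν) →
      (blockOf ((x.shift μ).shift ν) = y ∨ blockOf ((x.shift μ).shift ν) = y.shift μ ∨ blockOf ((x.shift μ).shift ν) = y.shift ν ∨
        blockOf ((x.shift μ).shift ν) = (y.shift μ).shift ν) → |curlAt a x μ ν| ≤ B) :
    |curlAt (linAvg04 a) y μ ν| ≤ (P.L : ℝ) ^ 2 * B := by
  unfold curlAt
  refine abs_curl_linAvg04_le a y μ ν fun r s t hs ht => ?_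
  obtain ⟨h1, h2⟩ := blockOf_rectPlaq_mem_four hj y hμν (offPt y (off r)) (off r)
    (fun κ => by rw [offPt, walkEnd_stairWord_apply]) (off_bounds r) hs ht
  exact hB _ h1 h2

/-! ## §3 Curl bounds of the iterated linear averages on a nested family of regions -/

section Region

/-- In the four-block product set, the lower-left and upper-right corners of a unit square control the other two corners (`μ ≠ ν`; coordinate mixing). [folklore] -/
theorem blockOf_shift_mem_four (y : Site P (j + 1)) {μ ν : Fin P.d} (hμν : μ ≠ ν) (x : Site P j)
    (h1 : blockOf x = y ∨ blockOf x = y.shift μ ∨ blockOf x = y.shift ν ∨ blockOf x = (y.shift μ).shift ν)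
    (h2 : blockOf ((x.shift μ).shift ν) = y ∨ blockOf ((x.shift μ).shift ν) = y.shift μ ∨ blockOf ((x.shift μ).shift ν) = y.shift ν ∨
      blockOf ((x.shift μ).shift ν) = (y.shift μ).shift ν) :
    (blockOf (x.shift μ) = y ∨ blockOf (x.shift μ) = y.shift μ ∨ blockOf (x.shift μ) = y.shift ν ∨ blockOf (x.shift μ) = (y.shift μ).shift ν) ∧
    (blockOf (x.shift ν) = y ∨ blockOf (x.shift ν) = y.shift μ ∨ blockOf (x.shift ν) = y.shift ν ∨ blockOf (x.shift ν) = (y.shift μ).shift ν) := by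
  have hne : ((μ, true) : Letter P.d).1 ≠ ((ν, true) : Letter P.d).1 := hμν
  have e1 : x.shift μ = walkEnd x [(μ, true)] := rfl
  have e2 : x.shift ν = walkEnd x [(ν, true)] := rfl
  have e3 : (x.shift μ).shift ν = walkEnd x [(μ, true), (ν, true)] := rfl
  rw [e3] at h2
  obtain ⟨hμ', hν'⟩ := walkEnd_single_mem_pi hne ((blockOf_mem_four_iff y hμν _).1 h1) ((blockOf_mem_four_iff y hμν _).1 h2)
  rw [e1, e2]
  exact ⟨(blockOf_mem_four_iff y hμν _).2 hμ', (blockOf_mem_four_iff y hμν _).2 hν'⟩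

/-- **★ REGIONAL PROPAGATION OF CURL BOUNDS THROUGH THE ITERATED LINEAR AVERAGES**: for a nested family `R` of coarse-site sets (`z ∈ R i ↔ blockOf z ∈ R (i+1)` for `i < k`,
`k ≤ m + K`), if `|curl a (x; μ, ν)| ≤ B` at every fine position `x` whose unit square `x, x+e_μ, x+e_ν, x+e_μ+e_ν` lies in `R 0` (`μ ≠ ν`), then for every `s ≤ k` and every level-`s`
position `y` whose unit square lies in `R s`: `|curl (linAvgIter s a)(y; μ, ν)| ≤ (L²)^s·B`. [cite: Balaban1987RG1, (0.4)+(0.11) p.253] -/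
theorem abs_curlAt_linAvgIter_le_region (k : ℕ) (hk : k ≤ P.m + P.K) (R : (i : ℕ) → Set (Site P i))
    (hR : ∀ i, i < k → ∀ z : Site P i, z ∈ R i ↔ blockOf z ∈ R (i + 1)) (a : PBond P 0 → ℝ) {B : ℝ}
    (hB : ∀ (x : Site P 0) (μ ν : Fin P.d), μ ≠ ν → x ∈ R 0 → x.shift μ ∈ R 0 → x.shift ν ∈ R 0 → (x.shift μ).shift ν ∈ R 0 → |curlAt a x μ ν| ≤ B) :
    ∀ (s : ℕ), s ≤ k → ∀ (y : Site P s) (μ ν : Fin P.d), μ ≠ ν → y ∈ R s → y.shift μ ∈ R s → y.shift ν ∈ R s → (y.shift μ).shift ν ∈ R s →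
      |curlAt (linAvgIter s a) y μ ν| ≤ ((P.L : ℝ) ^ 2) ^ s * B
  | 0, _, y, μ, ν, hμν, h1, h2, h3, h4 => by simpa [linAvgIter] using hB y μ ν hμν h1 h2 h3 h4
  | s + 1, hs, y, μ, ν, hμν, h1, h2, h3, h4 => by
    rw [linAvgIter_succ, pow_succ, mul_comm (((P.L : ℝ) ^ 2) ^ s), mul_assoc]
    have hmem : ∀ z : Site P s, (blockOf z = y ∨ blockOf z = y.shift μ ∨ blockOf z = y.shift ν ∨ blockOf z = (y.shift μ).shift ν) → z ∈ R s := by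
      intro z hz
      rw [hR s (Nat.lt_of_succ_le hs) z]
      rcases hz with h | h | h | h <;> rw [h] <;> assumption
    refine abs_curl_linAvg04_le_fourBlock (hs.trans hk) (linAvgIter s a) y hμν fun x hx1 hx2 => ?_
    obtain ⟨hxμ, hxν⟩ := blockOf_shift_mem_four y hμν x hx1 hx2
    exact abs_curlAt_linAvgIter_le_region k hk R hR a hB s (Nat.le_of_succ_le hs) x μ ν hμν (hmem _ hx1) (hmem _ hxμ) (hmem _ hxν) (hmem _ hx2)

end Region

/-! ## §4 The EML identity on a region, from the regional curl bound -/

section SUNRegion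

variable {N : ℕ} [NeZero N] {Y : Matrix (Fin N) (Fin N) ℂ} (hY : Y ∈ (suGroupModel N).lie)

/-- In the two-block product set of a coarse bond, the lower-left and upper-right corners of a unit square control the other two corners (`μ ≠ ν`). [folklore] -/
theorem blockOf_shift_mem_pair (c : PBond P (j + 1)) {μ ν : Fin P.d} (hμν : μ ≠ ν) (x : Site P j)
    (h1 : blockOf x = c.src ∨ blockOf x = c.tgt) (h2 : blockOf ((x.shift μ).shift ν) = c.src ∨ blockOf ((x.shift μ).shift ν) = c.tgt) :
    (blockOf (x.shift μ) = c.src ∨ blockOf (x.shift μ) = c.tgt) ∧ (blockOf (x.shift ν) = c.src ∨ blockOf (x.shift ν) = c.tgt) := by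
  have hne : ((μ, true) : Letter P.d).1 ≠ ((ν, true) : Letter P.d).1 := hμν
  have e1 : x.shift μ = walkEnd x [(μ, true)] := rfl
  have e2 : x.shift ν = walkEnd x [(ν, true)] := rfl
  have e3 : (x.shift μ).shift ν = walkEnd x [(μ, true), (ν, true)] := rfl
  rw [e3] at h2
  obtain ⟨hμ', hν'⟩ := walkEnd_single_mem_pi hne ((blockOf_mem_pair_iff c _).1 h1) ((blockOf_mem_pair_iff c _).1 h2)
  rw [e1, e2]
  exact ⟨(blockOf_mem_pair_iff c _).2 hμ', (blockOf_mem_pair_iff c _).2 hν'⟩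

/-- **★★ THE `s`-FOLD (0.4)/`exp[mean log]` AVERAGE OF AN ABELIAN CONFIGURATION IS ABELIAN AT THE BONDS UNDER THE REGION**: for a nested family `R` (levels `≤ k ≤ m + K`), fine curls `≤ B`
at the unit squares in `R 0`, and the level thresholds `(π/2)(((d+2)L)²/4)·((L²)^s B)·‖Y‖ < min(δ_N, ln 2)` for `s < k`: for every `s ≤ k` and every level-`s` bond `c` with both endpoints in
`R s`, `(blockAvg ℰp)^s (gexpAt a) c = gexpAt (linAvgIter s a) c`.  Exact two-block locality (`T4ReflectionConeSharp.avgFun_congr₂`) + the pointwise EML identity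
(`blockAvg_gexpAt_apply`) with the loop sums bounded from the two blocks (§1, §3). [cite: Balaban1987RG1, (0.4)+(0.11) p.253] -/
theorem iter_blockAvg_gexpAt_region (hY0 : Y ≠ 0) (k : ℕ) (hk : k ≤ P.m + P.K) (R : (i : ℕ) → Set (Site P i))
    (hR : ∀ i, i < k → ∀ z : Site P i, z ∈ R i ↔ blockOf z ∈ R (i + 1)) (a : PBond P 0 → ℝ) {B : ℝ} (hB0 : 0 ≤ B)
    (hB : ∀ (x : Site P 0) (μ ν : Fin P.d), μ ≠ ν → x ∈ R 0 → x.shift μ ∈ R 0 → x.shift ν ∈ R 0 → (x.shift μ).shift ν ∈ R 0 → |curlAt a x μ ν| ≤ B)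
    (hthr : ∀ s, s < k → Real.pi / 2 * (((((P.d + 2) * P.L : ℕ) : ℝ) ^ 2 / 4) * (((P.L : ℝ) ^ 2) ^ s * B)) * ‖Y‖ < min (deltaSU (Fin N)) (Real.log 2)) :
    ∀ (s : ℕ), s ≤ k → ∀ c : PBond P s, c.src ∈ R s → c.tgt ∈ R s →
      Averaging.iter (fun i => blockAvg (P := P) (j := i) (expMeanLogSU (n := Fin N))) s (gexpAt (suGroupModel N) hY a) c =
        gexpAt (suGroupModel N) hY (linAvgIter s a) c
  | 0, _, _, _, _ => rfl
  | s + 1, hs, c, hcs, hct => by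
    have hs' : s < k := Nat.lt_of_succ_le hs
    have hsmK : s + 1 ≤ P.m + P.K := hs.trans hk
    -- membership of the level-`s` sites of the two blocks
    have hmem : ∀ z : Site P s, (blockOf z = c.src ∨ blockOf z = c.tgt) → z ∈ R s := by
      intro z hz
      rw [hR s hs' z]
      rcases hz with h | h <;> rw [h]
      · exact hcs
      · exact hct
    -- (i) exact locality: the `(s+1)`-st average at `c` reads the `s`-fold averages on the bonds with both ends in the two blocks, where the induction hypothesis applies
    have hIH : ∀ b : PBond P s, (blockOf b.src = c.src ∨ blockOf b.src = c.tgt) → (blockOf b.tgt = c.src ∨ blockOf b.tgt = c.tgt) →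
        Averaging.iter (fun i => blockAvg (P := P) (j := i) (expMeanLogSU (n := Fin N))) s (gexpAt (suGroupModel N) hY a) b =
          gexpAt (suGroupModel N) hY (linAvgIter s a) b :=
      fun b hb1 hb2 => iter_blockAvg_gexpAt_region hY0 k hk R hR a hB0 hB hthr s hs'.le b (hmem _ hb1) (hmem _ hb2)
    show (blockAvg (P := P) (j := s) (expMeanLogSU (n := Fin N))).avg (Averaging.iter _ s _) c = _
    rw [blockAvg_avg, avgFun_congr₂ (expMeanLogSU (n := Fin N)) hsmK _ (gexpAt (suGroupModel N) hY (linAvgIter s a)) c hIH, linAvgIter_succ]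
    -- (ii) the pointwise EML identity at `c`: loop sums from the curls of the two blocks
    have hcurl : ∀ p : Plaq P s, (blockOf p.src = c.src ∨ blockOf p.src = c.tgt) →
        (blockOf ((p.src.shift p.μ).shift p.ν) = c.src ∨ blockOf ((p.src.shift p.μ).shift p.ν) = c.tgt) →
        |curlAt (linAvgIter s a) p.src p.μ p.ν| ≤ ((P.L : ℝ) ^ 2) ^ s * B := by
      intro p h1 h2
      obtain ⟨hμ', hν'⟩ := blockOf_shift_mem_pair c (ne_of_lt p.hμν) p.src h1 h2
      exact abs_curlAt_linAvgIter_le_region k hk R hR a hB s hs'.le p.src p.μ p.ν (ne_of_lt p.hμν) (hmem _ h1) (hmem _ hμ') (hmem _ hν') (hmem _ h2)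
    have hloop : ∀ i, |loopSum (linAvgIter s a) c i| * ‖Y‖ < min (deltaSU (Fin N)) (Real.log 2) := fun i =>
      (mul_le_mul_of_nonneg_right (abs_loopSum_le_twoBlock (suGroupModel N) hsmK hY hY0 (linAvgIter s a) (by positivity) c hcurl i) (norm_nonneg _)).trans_lt
        (hthr s hs')
    exact avgFun_gexpAt hY (linAvgIter s a) c
      (fun i => (dist1_loopHol_gexpAt_le (suGroupModel N) hY _ c i).trans_lt ((hloop i).trans_le (min_le_left _ _)))
      (fun i => (hloop i).trans_le (min_le_right _ _))

end SUNRegion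

end Summit.QuantumFields.YangMills.Theorems.AbelianEML

end
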